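import Literature.AnabelianGeometry.SemiGraphs.TemperedReconstructionCor39CollapseRefutation
import HarnessLib

/-!
# Definition 3.8, compatible reading (`IsCompatiblyQuasiGeometric`): NON-VACUITY and SEPARATION from the
# literal reading at one finite graph of anabelioids

Mochizuki, *Semi-graphs of anabelioids*, Publ. RIMS **42** (2006), §3, Definition 3.8, manuscript p. 42
[cite: MochizukiSemiAnbd2006, Def 3.8 p.42]: "any maximal compact subgroup `K₁ ⊆ Π₁` (respectively,
nontrivial intersection `K₁ ∩ H₁` of two distinct maximal compact subgroups `K₁, H₁ ⊆ Π₁`) maps surjectively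
to an open subgroup of some maximal compact subgroup `K₂ ⊆ Π₂` (respectively, of some nontrivial intersection
`K₂ ∩ H₂` of two distinct maximal compact subgroups `K₂, H₂ ⊆ Π₂`)".

PROOF-ONLY file (0 definitions) of the abc-iut cell, L-F sub-cell [SemiAnbd]+[CombGC] pack A, FACT-LIST row
F-2731 `IsCompatiblyQuasiGeometric` (a predicate: the tree's COMPATIBLE reading of Def. 3.8, additive companion
of the frozen literal `IsQuasiGeometric`; L3-lead rulings β1 (4) / β3, seat abc-iut-w6-d099).  Disposition
PRED-NV: nothing to discharge; the L-F unit is a non-vacuity instance at a genuine carrier.  At the FINITE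
graph of anabelioids `𝓛 = IwahoriWitness.loopGraph p` of abc-iut-w5-d236 (one vertex with
`P = ℤ_p ⋊ (1 + pℤ_p)`, one estranged loop; `Cor39Hypotheses` kernel-checked) and EVERY chart `c` of
`π₁^temp(𝓛)`, this file records BY NAME, from abc-iut-L3-t12's `IwahoriWitness.exists_collapseFold`
(`TemperedReconstructionCor39CollapseRefutation.lean`) and `not_isCompatiblyQuasiGeometric_of_range_le`
(`TemperedReconstructionCor39LiteralFold.lean`):

* `IwahoriWitness.exists_isCompatiblyQuasiGeometric` — the predicate is INHABITED at `π₁^temp(𝓛)` (the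
  identity; Rmk. 3.8.1);
* `IwahoriWitness.exists_isQuasiGeometric_not_isCompatiblyQuasiGeometric` — the predicate is STRICTLY
  STRONGER than the literal `IsQuasiGeometric` at `π₁^temp(𝓛)`: the collapse fold is quasi-geometric in the
  literal reading and not in the compatible one (the kernel form, at one graph and every chart, of cell
  finding t2g2-F1);
* `IwahoriWitness.isCompatiblyQuasiGeometric_separates` — both at once, for the canonical chart, as a closed
  statement (`p` prime).

HONEST FRAMING.  A non-vacuity / separation datum for OUR two typed readings of a definition; nothing here
bears on [IUTchIII] Cor. 3.12; typed ≠ proved.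
-/

noncomputable section

namespace Literature.AnabelianGeometry.SemiGraphs

namespace IwahoriWitness

open ProfiniteSemiGraph

variable (p : ℕ) [Fact p.Prime]

/-- **`IsCompatiblyQuasiGeometric` is inhabited at `π₁^temp(𝓛)`** (every chart): the identity of the
tempered fundamental group of the Iwahori loop graph is compatibly quasi-geometric ([SemiAnbd] Rmk. 3.8.1
p. 42, "any isomorphism of temperoids is quasi-geometric", compatible form
`IsCompatiblyQuasiGeometric.of_continuousMulEquiv`). [cite: MochizukiSemiAnbd2006, Rmk 3.8.1 p.42] -/
theorem exists_isCompatiblyQuasiGeometric (c : TemperedPiChart (loopGraph p)) :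
    ∃ φ : c.G →ₜ* c.G, IsCompatiblyQuasiGeometric φ :=
  ⟨(ContinuousMulEquiv.refl c.G : c.G →ₜ* c.G),
    IsCompatiblyQuasiGeometric.of_continuousMulEquiv (ContinuousMulEquiv.refl c.G)⟩

/-- **The compatible reading of Def. 3.8 is strictly stronger than the literal one at `π₁^temp(𝓛)`**
(every chart `c` of the FINITE graph of anabelioids `𝓛 = loopGraph p`): the collapse fold `φ` of
`exists_collapseFold` is quasi-geometric in the literal reading (`IsQuasiGeometric φ`), has range in a
verticial subgroup, and `π₁^temp(𝓛)` has two distinct maximal compact subgroups meeting nontrivially — so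
`φ` is NOT quasi-geometric in the compatible reading (`not_isCompatiblyQuasiGeometric_of_range_le`, Thm. 3.7
(ii)/(iv) at the finite `𝓛`). [cite: MochizukiSemiAnbd2006, Def 3.8 p.42] -/
theorem exists_isQuasiGeometric_not_isCompatiblyQuasiGeometric (c : TemperedPiChart (loopGraph p)) :
    ∃ φ : c.G →ₜ* c.G, IsQuasiGeometric φ ∧ ¬ IsCompatiblyQuasiGeometric φ := by
  haveI : Finite (loopGraph p).graph.Vertex := inferInstanceAs (Finite PUnit)
  haveI : Finite (loopGraph p).graph.Edge := inferInstanceAs (Finite (ULift (Fin 1)))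
  obtain ⟨φ, hqg, ⟨v, V, hV, hrange⟩, K₁, H₁, hK₁, hH₁, hne, hint⟩ := exists_collapseFold p c
  exact ⟨φ, hqg, not_isCompatiblyQuasiGeometric_of_range_le (loopGraph_cor39Hypotheses p).thm37Hypotheses
    c φ hqg hV hrange hK₁ hH₁ hne hint⟩

/-- **Separation datum for F-2731, closed form** (canonical chart of [SemiAnbd] Prop. 3.6,
`ProfiniteSemiGraph.temperedPiChart`): at the tempered fundamental group of the Iwahori loop graph there is a
compatibly quasi-geometric endomorphism AND a literally-but-not-compatibly quasi-geometric endomorphism.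
[cite: MochizukiSemiAnbd2006, Def 3.8 p.42] -/
theorem isCompatiblyQuasiGeometric_separates :
    let c := (loopGraph p).temperedPiChart (loopGraph_prop36Hypotheses p)
    (∃ φ : c.G →ₜ* c.G, IsCompatiblyQuasiGeometric φ) ∧
      ∃ φ : c.G →ₜ* c.G, IsQuasiGeometric φ ∧ ¬ IsCompatiblyQuasiGeometric φ :=
  ⟨exists_isCompatiblyQuasiGeometric p _, exists_isQuasiGeometric_not_isCompatiblyQuasiGeometric p _⟩

end IwahoriWitness

end Literature.AnabelianGeometry.SemiGraphs

end
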